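import Summits.QuantumFields.BalabanUV.Beta.D1BFx.PackedKernelSplit
import Summits.QuantumFields.BalabanUV.Beta.SpineRecursiveParity

/-!
# `BalabanUV.Beta.D1BFx.PackedParity` — road «BF-x» for binder row D1, slot (K), debt X₄ («K-R4 re-read against N_R's ℋ-column»):
# the SIGN-CONJUGATE SYMMETRY of a PACKED (field ⊕ multiplier) kernel READ OFF ITS FOUR LETTERS, and the consequence that the
# SECOND-RESPONSE summand `dM (K2OfK K N S M c) N S M b` of the second-order carrier has ZERO tadpole against ANY such packed leg
# whenever the first-order tables have parity-odd rows — generic in the letters `(Γ, H, M)`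

HONEST DEPENDENCY (page 1, mandatory): continuum YM on T⁴ ⇐ BetaPertH ∧ nine spine estimates (0/9 proved); BetaPertH ⇐ (D1) ∧ (D4) ∧
CAP+tail; G-an2-4 gates asym, D1 and NE2/3/4.  HONEST FRAMING (cell contract, verbatim): «discharging `BetaPertH` makes Bałaban's UV
stability UNCONDITIONAL — a real constructive-QFT result; it is NOT the continuum limit and NOT the Clay problem.»  THIS MODULE DISCHARGES
NOTHING of D1 / BetaPertH: it is [folklore] finite bookkeeping over `PackedKernelSplit` (`packK`, `blk`), `BorderedHessianSymmetry` (`sgnK`),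
`KernelWardRelativeEnd.tadpole_eq_zero_of_parity` and `SpineRecursiveParity` (`parityOdd_dM`, `tadpole_dM_eq_zero_of_rows`) BY NAME.  No
`def … : Prop`, no citation, no printed statement as hypothesis, no [our object] definition; 0 binders of the hR/hW roots touched.  NOT summit
progress; NOT BetaPertH, NOT continuum, NOT Clay.
ABSOLUTE RULE (cell charter, verbatim): «No internally-minted statement may enter as a cited fact. Every hypothesis is either
kernel-proved in this package or a verbatim quotation of a PUBLISHED theorem with page reference. The manuscript(s) under audit are NOT
citable for their own disputed steps — they are the thing under adjudication; programme-internal (2001/route/tribunal) claims are never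
citable.»

WHY (owner's `K-R1-SPEC-v2.md` §4, debt X₄ «K-R4 (second response, representation dependence of `W₀`): IN TREE at the needed generality?
(`Criticality`, `CriticalityWall`, `TadpoleParity`) — to be re-read against N_R's ℋ-column»).  The lineage's K-R4 verdict v2 (`K-R4-CHECK.md`
§3) is: in the NATIVE placement every row of the first-order tables is parity-ODD (`trK V = −sgnK V`), so EVERY one-point function against a
sgn-SYMMETRIC spread leg `K` (`trK K = sgnK K`) vanishes, hence the second-response summand contributes nothing (`SpineRecursiveParity
.tadpole_dM_eq_zero_of_rows`, any weight kernel `K′`, in particular `K′ := K2OfK K N S M c`).  For the row's literal the leg is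
`coDressKBmAt ρ n (KInvStep n j)` (`BubbleParity.trK_coDressKBmAt_KInvStep`).  On the RIGHT side of slot (K) the legs are the R-WEIGHTED packed
kernel N_R = `packK Γ_R ℋ_R ℋ♭_R M_R` (the owner's K-ASSEMBLY objects — NOT defined here).  This file proves, ONCE AND FOR EVERY PACKED KERNEL,
that sgn-conjugate symmetry is EXACTLY the three letter relations `Γᵀ = Γ`, `ℋ♭ = −ℋᵀ`, `Mᵀ = M` (§2), so that X₄ = option (a) OUTRIGHT for
N_R the moment its letters are typed with `GluonLeg.trK_Ga`-type symmetry of the ff letter, the `−ℋᵀ` convention for the mf letter (as in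
`BorderedHessianSymmetry.trK_KInv`: `ℋ♭ = −ℋᵀ` by `ResolventComposition.GamΦ_quo_eq_neg_wH`) and a symmetric mm letter (§3).

CONTENT.
* §1 [folklore] transposition and sign conjugation THROUGH THE PACKER: `trK_packK` (`(packK A B C D)ᵀ = packK Aᵀ Cᵀ Bᵀ Dᵀ` — the off-diagonal
  blocks swap), `sgnK_packK` (`S·(packK A B C D)·S = packK A (−B) (−C) D`), block readers `blk_trK_*`, `blk_sgnK_*`, `neg_packK`.
* §2 [folklore] **`trK_packK_eq_sgnK_iff`**: `trK (packK Γ H Φ M) = sgnK (packK Γ H Φ M) ↔ trK Γ = Γ ∧ Φ = −trK H ∧ trK M = M`; the packaged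
  sufficient form **`trK_packK_eq_sgnK`** (`Φ := −trK H`); and the converse readers for ANY sgn-symmetric packed kernel
  (`blk_tt_symm_of_trK_eq_sgnK`, `blk_ft_eq_neg_trK_blk_tf_of_trK_eq_sgnK`, `blk_ff_symm_of_trK_eq_sgnK`); parity-ODD analogue
  **`trK_packK_eq_neg_sgnK_iff`** (`Γᵀ = −Γ ∧ Φ = Hᵀ ∧ Mᵀ = −M` — the shape of the first-order TABLES).
* §3 [folklore] X₄ FOR PACKED LEGS: **`tadpole_packK_eq_zero_of_parityOdd`** (spread letters, `Φ = −Hᵀ`, symmetric `Γ`, `M`; any localised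
  parity-odd `V`: `tadpole (packK Γ H (−Hᵀ) M) V = 0`), **`tadpole_dM_packK_eq_zero_of_rows`** (any weight kernel `K′`, parity-odd rows of `S`,
  `M₁`), and the second-response instance **`tadpole_secondResponse_packK_eq_zero_of_rows`** (`K′ := K2OfK (packK …) N S M₁ c` — the K-R4
  summand of `SecondOrderResponse.W2OfK` against the packed leg itself).
NOT HERE (honest): the R-weighted letters `Γ_R`, `ℋ_R`, `M_R` and their symmetry∕decay (owner's K-ASSEMBLY; inputs in tree: `GluonLeg.trK_Ga`,
`GAN24.TransverseDictionary.wΦ_symm`, `CoarseLegJunction.Cun_eq_wΦ`, `LandauDictionaryInstance`); the bubble part of the carrier (not a parity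
statement); any estimate.  Unit `b2b-balaban-beta-d1-formalise-leaf-03` (gen 8), D1 formalisation swarm, 2026-08-20.
-/

noncomputable section

namespace Summit.QuantumFields.BalabanUV.Beta.D1BFx.PackedParity

open Literature.MathematicalPhysics.QuantumFieldTheory.Balaban1983to89.Beta
open ExpKernelCalculus (Site MKer tadpole)
open OneStepResolventKernel (Fib)
open SecondOrderResponse (dM K2OfK)
open Summit.QuantumFields.BalabanUV.Beta.TameKernelCalculus
open Summit.QuantumFields.BalabanUV.Beta.BorderedHessian (sgnF sgnF_inl sgnF_inr sgnK sgnK_apply spr_sgnK)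
open Summit.QuantumFields.BalabanUV.Beta.KernelWardRelativeEnd (tadpole_eq_zero_of_parity)
open Summit.QuantumFields.BalabanUV.Beta.SpineRecursiveParity (parityOdd_dM tadpole_dM_eq_zero_of_rows)
open Summit.QuantumFields.BalabanUV.Beta.D1BFx.PackedKernelSplit (blk packK blk_tt blk_tf blk_ft blk_ff blk_packK_tt blk_packK_tf
  blk_packK_ft blk_packK_ff packK_blk spr_packK)

variable {D : ℕ} {F : Type*} {d : ℕ}

/-! ## §1 Transposition and sign conjugation through the packer -/

section Packer

/-- [folklore] The negative of a spread kernel is spread (same constant and rate). -/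
theorem spr_neg {A : MKer (d + 1) (Fin (d + 1))} (h : Spr A) : Spr (-A) := by
  obtain ⟨C, δ, hδ, hA⟩ := h
  refine ⟨C, δ, hδ, fun x y a b => ?_⟩
  show |-(A x y a b)| ≤ _
  rw [abs_neg]
  exact hA x y a b

/-- [folklore] **TRANSPOSE OF A PACKED KERNEL**: `(packK A B C D)ᵀ = packK Aᵀ Cᵀ Bᵀ Dᵀ` — the diagonal blocks transpose in place, the
off-diagonal blocks transpose AND swap. -/
theorem trK_packK (A B C E : MKer D F) : trK (packK A B C E) = packK (trK A) (trK C) (trK B) (trK E) := by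
  funext x z a b
  cases a <;> cases b <;> rfl

/-- [folklore] The ff block of a transpose is the transpose of the ff block. -/
theorem blk_trK_tt (K : MKer D (F ⊕ F)) : blk (trK K) true true = trK (blk K true true) := rfl
/-- [folklore] The fm block of a transpose is the transpose of the mf block. -/
theorem blk_trK_tf (K : MKer D (F ⊕ F)) : blk (trK K) true false = trK (blk K false true) := rfl
/-- [folklore] The mf block of a transpose is the transpose of the fm block. -/
theorem blk_trK_ft (K : MKer D (F ⊕ F)) : blk (trK K) false true = trK (blk K true false) := rfl
/-- [folklore] The mm block of a transpose is the transpose of the mm block. -/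
theorem blk_trK_ff (K : MKer D (F ⊕ F)) : blk (trK K) false false = trK (blk K false false) := rfl

/-- [folklore] Negation passes through the packer blockwise. -/
theorem neg_packK (A B C E : MKer D F) : -packK A B C E = packK (-A) (-B) (-C) (-E) := by
  funext x z a b
  cases a <;> cases b <;> rfl

/-- [folklore] **SIGN CONJUGATION OF A PACKED KERNEL**: `S·(packK A B C D)·S = packK A (−B) (−C) D` (`S = diag(+1 field, −1 multiplier)`):
the diagonal blocks are fixed, the off-diagonal blocks are negated. -/
theorem sgnK_packK (A B C E : MKer (d + 1) (Fin (d + 1))) :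
    sgnK (packK A B C E) = packK A (-B) (-C) E := by
  funext x z a b
  rw [sgnK_apply]
  rcases a with a | a <;> rcases b with b | b
  · show 1 * 1 * A x z a b = A x z a b; ring
  · show 1 * -1 * B x z a b = -B x z a b; ring
  · show -1 * 1 * C x z a b = -C x z a b; ring
  · show -1 * -1 * E x z a b = E x z a b; ring

/-- [folklore] The ff block is fixed by sign conjugation. -/
theorem blk_sgnK_tt (K : MKer (d + 1) (Fib d)) : blk (sgnK K) true true = blk K true true := by
  funext x z a b; show 1 * 1 * K x z (Sum.inl a) (Sum.inl b) = K x z (Sum.inl a) (Sum.inl b); ring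
/-- [folklore] The fm block is negated by sign conjugation. -/
theorem blk_sgnK_tf (K : MKer (d + 1) (Fib d)) : blk (sgnK K) true false = -blk K true false := by
  funext x z a b; show 1 * -1 * K x z (Sum.inl a) (Sum.inr b) = -K x z (Sum.inl a) (Sum.inr b); ring
/-- [folklore] The mf block is negated by sign conjugation. -/
theorem blk_sgnK_ft (K : MKer (d + 1) (Fib d)) : blk (sgnK K) false true = -blk K false true := by
  funext x z a b; show -1 * 1 * K x z (Sum.inr a) (Sum.inl b) = -K x z (Sum.inr a) (Sum.inl b); ring
/-- [folklore] The mm block is fixed by sign conjugation. -/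
theorem blk_sgnK_ff (K : MKer (d + 1) (Fib d)) : blk (sgnK K) false false = blk K false false := by
  funext x z a b; show -1 * -1 * K x z (Sum.inr a) (Sum.inr b) = K x z (Sum.inr a) (Sum.inr b); ring

/-- [folklore] Two packed kernels agree iff their four letters agree. -/
theorem packK_inj_iff {A B C E A' B' C' E' : MKer D F} :
    packK A B C E = packK A' B' C' E' ↔ A = A' ∧ B = B' ∧ C = C' ∧ E = E' := by
  constructor
  · intro h
    refine ⟨?_, ?_, ?_, ?_⟩
    · rw [← blk_packK_tt A B C E, h, blk_packK_tt]
    · rw [← blk_packK_tf A B C E, h, blk_packK_tf]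
    · rw [← blk_packK_ft A B C E, h, blk_packK_ft]
    · rw [← blk_packK_ff A B C E, h, blk_packK_ff]
  · rintro ⟨rfl, rfl, rfl, rfl⟩; rfl

end Packer

/-! ## §2 Sign-conjugate symmetry of a packed kernel = three letter relations -/

section Criterion

/-- [folklore] **SIGN-CONJUGATE SYMMETRY READ OFF THE LETTERS**: a packed kernel is sgn-symmetric (`Kᵀ = S K S`, the symmetry class of the
packed resolvents `KInv`, `KInvStep j`, `coDressKBmAt ρ n (KInvStep n j)`) iff its ff letter is symmetric, its mf letter is MINUS the transpose of
its fm letter, and its mm letter is symmetric. -/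
theorem trK_packK_eq_sgnK_iff (Γ H Φ M : MKer (d + 1) (Fin (d + 1))) :
    trK (packK Γ H Φ M) = sgnK (packK Γ H Φ M) ↔ trK Γ = Γ ∧ Φ = -trK H ∧ trK M = M := by
  rw [trK_packK, sgnK_packK, packK_inj_iff]
  constructor
  · rintro ⟨h1, h2, _, h4⟩
    refine ⟨h1, ?_, h4⟩
    rw [← trK_trK Φ, h2, trK_neg]
  · rintro ⟨h1, h2, h4⟩
    refine ⟨h1, ?_, ?_, h4⟩
    · rw [h2, trK_neg, trK_trK]
    · rw [h2, neg_neg]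

/-- [folklore] **THE PACKAGED SUFFICIENT FORM**: with the `−ℋᵀ` convention for the mf letter, symmetric ff and mm letters give a sgn-symmetric
packed kernel. -/
theorem trK_packK_eq_sgnK {Γ M : MKer (d + 1) (Fin (d + 1))} (hΓ : trK Γ = Γ) (hM : trK M = M) (H : MKer (d + 1) (Fin (d + 1))) :
    trK (packK Γ H (-trK H) M) = sgnK (packK Γ H (-trK H) M) :=
  (trK_packK_eq_sgnK_iff Γ H (-trK H) M).2 ⟨hΓ, rfl, hM⟩

/-- [folklore] Converse reader (ff): the ff block of a sgn-symmetric packed kernel is symmetric. -/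
theorem blk_tt_symm_of_trK_eq_sgnK {K : MKer (d + 1) (Fib d)} (h : trK K = sgnK K) :
    trK (blk K true true) = blk K true true := by
  rw [← blk_trK_tt, h, blk_sgnK_tt]

/-- [folklore] Converse reader (mf∕fm): the mf block of a sgn-symmetric packed kernel is minus the transpose of its fm block. -/
theorem blk_ft_eq_neg_trK_blk_tf_of_trK_eq_sgnK {K : MKer (d + 1) (Fib d)} (h : trK K = sgnK K) :
    blk K false true = -trK (blk K true false) := by
  have e : blk (trK K) true false = blk (sgnK K) true false := by rw [h]
  rw [blk_trK_tf, blk_sgnK_tf] at e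
  rw [← trK_trK (blk K false true), e, trK_neg]

/-- [folklore] Converse reader (mm): the mm block of a sgn-symmetric packed kernel is symmetric. -/
theorem blk_ff_symm_of_trK_eq_sgnK {K : MKer (d + 1) (Fib d)} (h : trK K = sgnK K) :
    trK (blk K false false) = blk K false false := by
  rw [← blk_trK_ff, h, blk_sgnK_ff]

/-- [folklore] **PARITY-ODDNESS READ OFF THE LETTERS** (the class of the first-order TABLES `wilsonA`, `vhSAt`, `hessFFAt`, `SrecAt j`): a packed
kernel is parity-odd (`Kᵀ = −S K S`) iff its ff and mm letters are antisymmetric and its mf letter IS the transpose of its fm letter. -/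
theorem trK_packK_eq_neg_sgnK_iff (Γ H Φ M : MKer (d + 1) (Fin (d + 1))) :
    trK (packK Γ H Φ M) = -sgnK (packK Γ H Φ M) ↔ trK Γ = -Γ ∧ Φ = trK H ∧ trK M = -M := by
  rw [trK_packK, sgnK_packK, neg_packK, neg_neg, neg_neg, packK_inj_iff]
  constructor
  · rintro ⟨h1, h2, _, h4⟩
    refine ⟨h1, ?_, h4⟩
    rw [← trK_trK Φ, h2]
  · rintro ⟨h1, h2, h4⟩
    exact ⟨h1, by rw [h2, trK_trK], by rw [h2], h4⟩

end Criterion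

/-! ## §3 X₄ for packed legs: one-point functions and the second-response summand vanish by parity -/

section Tadpole

/-- [folklore] **EVERY PARITY-ODD ONE-POINT FUNCTION AGAINST A PACKED LEG WITH SYMMETRIC LETTERS VANISHES**: for spread letters `Γ`, `H`, `M`
with `Γᵀ = Γ`, `Mᵀ = M`, the packed leg `packK Γ H (−Hᵀ) M` has `tadpole (packK …) V = 0` for every localised parity-odd `V`
(`KernelWardRelativeEnd.tadpole_eq_zero_of_parity`). -/
theorem tadpole_packK_eq_zero_of_parityOdd {Γ H M : MKer (d + 1) (Fin (d + 1))} (hΓs : Spr Γ) (hHs : Spr H) (hMs : Spr M)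
    (hΓ : trK Γ = Γ) (hM : trK M = M) {V : MKer (d + 1) (Fib d)} (hV : Loc V) (hVt : trK V = -sgnK V) :
    tadpole (packK Γ H (-trK H) M) V = 0 :=
  tadpole_eq_zero_of_parity (spr_packK hΓs hHs (spr_neg hHs.trK) hMs) (trK_packK_eq_sgnK hΓ hM H) hV hVt

/-- [folklore] **THE RESIDUAL SHAPE AGAINST A PACKED LEG**: for spread letters with `Γᵀ = Γ`, `Mᵀ = M` (mf letter `−Hᵀ`), ANY weight kernel
`K′`, row-parity-odd first-order tables `S`, `M₁`, and any bond at which `dM K′ N S M₁ μ y` is localised: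
`tadpole (packK Γ H (−Hᵀ) M) (dM K′ N S M₁ μ y) = 0` (`SpineRecursiveParity.tadpole_dM_eq_zero_of_rows`). -/
theorem tadpole_dM_packK_eq_zero_of_rows {Γ H M : MKer (d + 1) (Fin (d + 1))} (hΓs : Spr Γ) (hHs : Spr H) (hMs : Spr M)
    (hΓ : trK Γ = Γ) (hM : trK M = M) (K' : MKer (d + 1) (Fib d)) (N : ℕ)
    {S M₁ : Fin (d + 1) → (Fin (d + 1) → ℤ) → MKer (d + 1) (Fib d)} (hS : ∀ κ u, trK (S κ u) = -sgnK (S κ u))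
    (hM₁ : ∀ ρ w, trK (M₁ ρ w) = -sgnK (M₁ ρ w)) (μ : Fin (d + 1)) (y : Fin (d + 1) → ℤ) (hl : Loc (dM K' N S M₁ μ y)) :
    tadpole (packK Γ H (-trK H) M) (dM K' N S M₁ μ y) = 0 :=
  tadpole_dM_eq_zero_of_rows (spr_packK hΓs hHs (spr_neg hHs.trK) hMs) (trK_packK_eq_sgnK hΓ hM H) K' N hS hM₁ μ y hl

/-- [folklore] **X₄ FOR A PACKED LEG — THE SECOND-RESPONSE SUMMAND OF `W2OfK` HAS NO TADPOLE**: the K-R4 summand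
`dM (K2OfK K N S M₁ ν y′) N S M₁ μ y` of `SecondOrderResponse.W2OfK K N S M₁ S₂ M₂ μ y ν y′`, with the second response `K2OfK` taken THROUGH THE
PACKED LEG ITSELF (`K := packK Γ H (−Hᵀ) M` — its own ℋ-column), has zero one-point function against that leg, for row-parity-odd `S`, `M₁`
(once localised).  This is option (a) of the K-R4 check for every representation whose legs pack symmetric ff∕mm letters with the `−ℋᵀ` mf
convention — the typed resolvent `KInv` (`BorderedHessianSymmetry.trK_KInv`) and, by `trK_packK_eq_sgnK_iff`, any R-weighted re-packing with
the same three letter relations. -/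
theorem tadpole_secondResponse_packK_eq_zero_of_rows {Γ H M : MKer (d + 1) (Fin (d + 1))} (hΓs : Spr Γ) (hHs : Spr H) (hMs : Spr M)
    (hΓ : trK Γ = Γ) (hM : trK M = M) (N : ℕ)
    {S M₁ : Fin (d + 1) → (Fin (d + 1) → ℤ) → MKer (d + 1) (Fib d)} (hS : ∀ κ u, trK (S κ u) = -sgnK (S κ u))
    (hM₁ : ∀ ρ w, trK (M₁ ρ w) = -sgnK (M₁ ρ w)) (μ : Fin (d + 1)) (y : Fin (d + 1) → ℤ) (ν : Fin (d + 1)) (y' : Fin (d + 1) → ℤ)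
    (hl : Loc (dM (K2OfK (packK Γ H (-trK H) M) N S M₁ ν y') N S M₁ μ y)) :
    tadpole (packK Γ H (-trK H) M) (dM (K2OfK (packK Γ H (-trK H) M) N S M₁ ν y') N S M₁ μ y) = 0 :=
  tadpole_dM_packK_eq_zero_of_rows hΓs hHs hMs hΓ hM _ N hS hM₁ μ y hl

/-- [folklore] **READER FORM** (for a packed leg given as ONE kernel `K` with `trK K = sgnK K`, e.g. the LEFT side's
`coDressKBmAt ρ n (KInvStep n j)`, and for the RIGHT side's N_R once its sgn-symmetry is read off the letters by `trK_packK_eq_sgnK_iff`): the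
second-response summand through `K`'s own ℋ-column has zero tadpole against `K` for row-parity-odd tables. -/
theorem tadpole_secondResponse_eq_zero_of_rows {K : MKer (d + 1) (Fib d)} (hK : Spr K) (hKt : trK K = sgnK K) (N : ℕ)
    {S M₁ : Fin (d + 1) → (Fin (d + 1) → ℤ) → MKer (d + 1) (Fib d)} (hS : ∀ κ u, trK (S κ u) = -sgnK (S κ u))
    (hM₁ : ∀ ρ w, trK (M₁ ρ w) = -sgnK (M₁ ρ w)) (μ : Fin (d + 1)) (y : Fin (d + 1) → ℤ) (ν : Fin (d + 1)) (y' : Fin (d + 1) → ℤ)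
    (hl : Loc (dM (K2OfK K N S M₁ ν y') N S M₁ μ y)) :
    tadpole K (dM (K2OfK K N S M₁ ν y') N S M₁ μ y) = 0 :=
  tadpole_dM_eq_zero_of_rows hK hKt _ N hS hM₁ μ y hl

end Tadpole

end Summit.QuantumFields.BalabanUV.Beta.D1BFx.PackedParity

end
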